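import Summits.ValiantsHypothesis.ValiantsHypothesis.Theorems.BarrierLeverSuccinctHittingSetsForVPWinWin
import Summits.ValiantsHypothesis.ValiantsHypothesis.Theorems.BarrierLeverSuccinctHittingSetsForVPADDoor
import Summits.ValiantsHypothesis.ValiantsHypothesis.Theorems.BarrierLeverSuccinctHittingSetsForVPKRSTDoor
import Summits.ValiantsHypothesis.ValiantsHypothesis.Theses.BarrierLever

/-!
# Route BarrierLever — typed LINKS between the items `NaturalProofsSeparateVNP`
# (stmt-ValiantsHypothesis-18972), `KRSTForVP` (stmt-18967), `KRST2022` (stmt-18971, closed),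
# `SuccinctHittingSetsForVBP` (stmt-18966) and the crux `SuccinctHittingSetsForVP` (stmt-14610)

Helper file (`--supports stmt-ValiantsHypothesis-18972`; cell val-lit, NP corpus, seat val-lit-p1).
It closes NO item: every statement below is glue between the ROUTE decls of
`Summits/ValiantsHypothesis/ValiantsHypothesis/Theses/BarrierLever.lean` and the landed theorems
(`…Theorems.BarrierLever.SuccinctHittingSetsForVP.WinWin`, `…ADDoor`, `…KRSTDoor`, `…LevelOne`,
the route's `KRST2022_holds`), so that the items can be cited BY NAME.

What is recorded (all kernel facts, axioms standard):

* §0 the items unfold to the tree's vocabulary (`Iff.rfl` checks): `NaturalProofsSeparateVNP` is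
  `∃ b₁, WinWin.NaturalProofsSeparate b₁`; `KRSTForVP` is `PerExpHard → crux`; `KRST2022` is KRST's
  printed Main Theorem over `SmallDefinable`; `SuccinctHittingSetsForVBP` is the `ADDoor` hypothesis.
* §1 item 18972 versus the crux: `NaturalProofsSeparateVNP → ¬ SuccinctHittingSetsForVP`
  unconditionally, and under exponential hardness of the permanent (`∃ c m₀, PermanentExpHardWith ℂ c m₀`,
  the common hypothesis of items 18967/18971) the two are COMPLEMENTARY:
  `SuccinctHittingSetsForVP ∨ NaturalProofsSeparateVNP`, never both — the VNP half is the CLOSED item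
  `KRST2022` (Kumar–Ramya–Saptharishi–Tengse 2022, Main Theorem), no named-fact hypothesis.
* §2 item 18967: implied by the crux and by item 18966 (Berkowitz, `ADDoor`); EQUIVALENT to
  `PerExpHard → ¬ NaturalProofsSeparateVNP` (so a refutation of 18967 is exactly "the permanent is
  exponentially hard AND 18972"); equivalent to the jointly-`VP`-succinct-generator statement ★★
  (`WinWin.generator_iff_krstForVP`); implied by KRST's own succinctness hypothesis (`KRSTDoor`).
* §3 what item 18972 certifies: a slice separation `VNP_{n,b₁} ⊄ VP_{n,b}` infinitely often for
  every `b`, and its "vanishing + definable non-root" form (the shape a CKRST 2020-type construction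
  would have to deliver — Chatterjee–Kumar–Ramya–Saptharishi–Tengse 2020, Thm 1.1, gives vanishing on
  the `{-1,0,1}`-coefficient slice only, which is NOT this hypothesis).

WHAT THIS IS NOT: no item is closed; items 14610, 18967, 18972 remain OPEN (18972 is, under
hardness of the permanent, literally the negation of FSV Question 6); `VP ≠ VNP` is not proved and
nothing here is progress on it; the hardness of the permanent is a hypothesis, never asserted.

References: [KumarRamyaSaptharishiTengse2022] §1.2, Thm. MainThm, §4 (open problem 1);
[ForbesShpilkaVolk2018] Question 6, Lemma 13; [ChatterjeeKumarRamyaSaptharishiTengse2020] Thm 1.1.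
-/

-- layout Summits/ValiantsHypothesis/ValiantsHypothesis forces the duplicated namespace component
set_option linter.dupNamespace false

namespace Summit.ValiantsHypothesis.ValiantsHypothesis.Theorems.BarrierLever.NaturalProofsSeparateVNP

open MvPolynomial Literature.Barriers.ValiantsHypothesis Literature.Computability.AlgebraicComplexity
open Summit.ValiantsHypothesis.ValiantsHypothesis.Theorems.BarrierLever.SuccinctHittingSetsForVP

/-! ### §0 The items unfold to the tree's vocabulary -/

/-- Item 18972 is, verbatim, "for some `b₁`, natural proofs separate `VNP_{·,b₁}`" in the sense of
the landed `WinWin.NaturalProofsSeparate` (the inlined set is `SmallDefinable ℂ n b₁`).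
[cite: KumarRamyaSaptharishiTengse2022, §1.2] -/
theorem naturalProofsSeparateVNP_iff_exists :
    Theses.BarrierLever.NaturalProofsSeparateVNP ↔ ∃ b₁ : ℕ, WinWin.NaturalProofsSeparate b₁ :=
  Iff.rfl

/-- Item 18971 (closed) is KRST's Main Theorem over the tree's `SmallDefinable` and
`PermanentExpHardWith` (both inlined in the item). [cite: KumarRamyaSaptharishiTengse2022, Thm. MainThm] -/
theorem krst2022_iff :
    Theses.BarrierLever.KRST2022 ↔
      ((∃ c m₀ : ℕ, PermanentExpHardWith ℂ c m₀) → ∃ b : ℕ, ∀ a : ℕ, ∃ n₀ : ℕ, ∀ n : ℕ, n₀ ≤ n →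
        IsSuccinctHittingSet (degLEMonomials n) (SmallDefinable ℂ n b) (Distinguishers ℂ n a)) :=
  Iff.rfl

/-- Item 18967 is "exponential hardness of the permanent implies the crux".
[cite: KumarRamyaSaptharishiTengse2022, §4 (open problem 1)] -/
theorem krstForVP_iff :
    Theses.BarrierLever.KRSTForVP ↔
      ((∃ c m₀ : ℕ, PermanentExpHardWith ℂ c m₀) → Theses.BarrierLever.SuccinctHittingSetsForVP) :=
  Iff.rfl

/-- Item 18966 is the hypothesis of the landed `ADDoor.succinctHittingSetsForVP_of_forVBP`
(`ADDoor.SmallDet n b` inlined). [cite: ForbesShpilkaVolk2018, §1.3] -/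
theorem succinctHittingSetsForVBP_iff :
    Theses.BarrierLever.SuccinctHittingSetsForVBP ↔
      ∀ a : ℕ, ∃ b n₀ : ℕ, ∀ n : ℕ, n₀ ≤ n →
        IsSuccinctHittingSet (degLEMonomials n) (ADDoor.SmallDet n b) (Distinguishers ℂ n a) :=
  Iff.rfl

/-! ### §1 Item 18972 versus the crux 14610 and the closed item 18971 -/

/-- **18972 ⇒ ¬ 14610, unconditionally**: separating natural proofs refute FSV Question 6 over `ℂ`
(a level-one natural proof against `SmallCircuits ℂ n b` for every `b` contradicts the crux at its
first level, `levelOne_of_succinctHittingSetsForVP`). [cite: ForbesShpilkaVolk2018, Question 6] -/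
theorem not_succinctHittingSetsForVP_of_naturalProofsSeparateVNP
    (h : Theses.BarrierLever.NaturalProofsSeparateVNP) :
    ¬ Theses.BarrierLever.SuccinctHittingSetsForVP := by
  obtain ⟨b₁, hb₁⟩ := naturalProofsSeparateVNP_iff_exists.mp h
  exact WinWin.not_succinctHittingSetsForVP_of_separate hb₁

/-- **¬ 14610 ⇒ 18972 under hardness of the permanent**, through the CLOSED item 18971
(`Theses.BarrierLever.KRST2022_holds`): the exponent `b₁` is KRST's.
[cite: KumarRamyaSaptharishiTengse2022, Thm. MainThm] -/
theorem naturalProofsSeparateVNP_of_not_succinctHittingSetsForVP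
    (hper : ∃ c m₀ : ℕ, PermanentExpHardWith ℂ c m₀)
    (hQ : ¬ Theses.BarrierLever.SuccinctHittingSetsForVP) :
    Theses.BarrierLever.NaturalProofsSeparateVNP := by
  obtain ⟨b₁, hb₁⟩ := Theses.BarrierLever.KRST2022_holds hper
  exact ⟨b₁, WinWin.separate_of_not_succinctHittingSetsForVP hb₁ hQ⟩

/-- **WIN–WIN over the items** (no named-fact hypothesis): if the permanent is exponentially hard,
then the crux 14610 holds OR item 18972 holds. [cite: KumarRamyaSaptharishiTengse2022, §1.2] -/
theorem succinctHittingSetsForVP_or_naturalProofsSeparateVNP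
    (hper : ∃ c m₀ : ℕ, PermanentExpHardWith ℂ c m₀) :
    Theses.BarrierLever.SuccinctHittingSetsForVP ∨ Theses.BarrierLever.NaturalProofsSeparateVNP := by
  by_cases hQ : Theses.BarrierLever.SuccinctHittingSetsForVP
  · exact Or.inl hQ
  · exact Or.inr (naturalProofsSeparateVNP_of_not_succinctHittingSetsForVP hper hQ)

/-- **Under hardness of the permanent, item 18972 is EXACTLY the negation of the crux 14610.**
[cite: KumarRamyaSaptharishiTengse2022, §1.2] -/
theorem naturalProofsSeparateVNP_iff_not_succinctHittingSetsForVP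
    (hper : ∃ c m₀ : ℕ, PermanentExpHardWith ℂ c m₀) :
    Theses.BarrierLever.NaturalProofsSeparateVNP ↔ ¬ Theses.BarrierLever.SuccinctHittingSetsForVP :=
  ⟨not_succinctHittingSetsForVP_of_naturalProofsSeparateVNP,
    naturalProofsSeparateVNP_of_not_succinctHittingSetsForVP hper⟩

/-- Never both (unconditionally). [cite: ForbesShpilkaVolk2018, Question 6] -/
theorem not_naturalProofsSeparateVNP_and_succinctHittingSetsForVP :
    ¬ (Theses.BarrierLever.NaturalProofsSeparateVNP ∧ Theses.BarrierLever.SuccinctHittingSetsForVP) :=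
  fun h => not_succinctHittingSetsForVP_of_naturalProofsSeparateVNP h.1 h.2

/-! ### §2 Item 18967 (`KRSTForVP`) -/

/-- The crux implies item 18967 (the item is the V4 door, weaker than the crux).
[cite: KumarRamyaSaptharishiTengse2022, §4 (open problem 1)] -/
theorem krstForVP_of_succinctHittingSetsForVP (h : Theses.BarrierLever.SuccinctHittingSetsForVP) :
    Theses.BarrierLever.KRSTForVP :=
  fun _ => h

/-- **Items 18967 and 18972 are complementary doors**: `KRSTForVP` holds iff hardness of the
permanent rules OUT separating natural proofs. [cite: KumarRamyaSaptharishiTengse2022, §1.2 and §4] -/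
theorem krstForVP_iff_not_naturalProofsSeparateVNP :
    Theses.BarrierLever.KRSTForVP ↔
      ((∃ c m₀ : ℕ, PermanentExpHardWith ℂ c m₀) → ¬ Theses.BarrierLever.NaturalProofsSeparateVNP) :=
  ⟨fun h hper hsep => not_succinctHittingSetsForVP_of_naturalProofsSeparateVNP hsep (h hper),
    fun h hper => (succinctHittingSetsForVP_or_naturalProofsSeparateVNP hper).resolve_right (h hper)⟩

/-- Hence the refutation target for item 18967 is exactly "the permanent is exponentially hard AND
item 18972 holds". [cite: KumarRamyaSaptharishiTengse2022, §4 (open problem 1)] -/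
theorem not_krstForVP_iff :
    ¬ Theses.BarrierLever.KRSTForVP ↔
      (∃ c m₀ : ℕ, PermanentExpHardWith ℂ c m₀) ∧ Theses.BarrierLever.NaturalProofsSeparateVNP := by
  rw [krstForVP_iff_not_naturalProofsSeparateVNP, Classical.not_imp, not_not]

/-- Item 18966 implies the crux (route-decl form of the landed `ADDoor` theorem:
`VBP_{n,b} ⊆ VP_{n,7b+11}` by Berkowitz). [cite: ForbesShpilkaVolk2018, §1.3] -/
theorem succinctHittingSetsForVP_of_succinctHittingSetsForVBP
    (h : Theses.BarrierLever.SuccinctHittingSetsForVBP) :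
    Theses.BarrierLever.SuccinctHittingSetsForVP :=
  ADDoor.succinctHittingSetsForVP_of_forVBP h

/-- Item 18966 implies item 18967. [cite: ForbesShpilkaVolk2018, §1.3] -/
theorem krstForVP_of_succinctHittingSetsForVBP (h : Theses.BarrierLever.SuccinctHittingSetsForVBP) :
    Theses.BarrierLever.KRSTForVP :=
  krstForVP_of_succinctHittingSetsForVP (succinctHittingSetsForVP_of_succinctHittingSetsForVBP h)

/-- **★★ ↔ item 18967** (the landed `WinWin.generator_iff_krstForVP` at `H :=` hardness of the
permanent): "per-hardness gives, for all large `n`, a JOINTLY `VP`-succinct generator fooling the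
level-one distinguishers" is equivalent to `KRSTForVP`. [cite: ForbesShpilkaVolk2018, Lemma 13] -/
theorem jointGenerator_iff_krstForVP :
    ((∃ c m₀ : ℕ, PermanentExpHardWith ℂ c m₀) → ∃ b n₀ : ℕ, ∀ n : ℕ, n₀ ≤ n →
        ∃ (q : ℕ) (G : degLEMonomials n → MvPolynomial (Fin q) ℂ),
          (∃ Γ : MvPolynomial (Fin n ⊕ Fin q) ℂ, complexity Γ ≤ n ^ b ∧
            ∀ a : Fin q → ℂ, (aeval (Sum.elim X fun j => C (a j)) Γ).totalDegree ≤ n ∧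
              ∀ m : degLEMonomials n,
                coeff (m : Fin n →₀ ℕ) (aeval (Sum.elim X fun j => C (a j)) Γ) = eval a (G m)) ∧
          ∀ D ∈ Distinguishers ℂ n 1, D ≠ 0 → bind₁ G D ≠ 0) ↔
      Theses.BarrierLever.KRSTForVP :=
  WinWin.generator_iff_krstForVP _

/-- KRST's own door to item 18967: if hardness of the permanent came with `VP`-succinctness of KRST's
generator for SOME size exponent `b` (`KRSTDoor.KRSTSuccinctInVP ℂ c b`, an unproven hypothesis,
refuted in the band `5b + 24 ≤ 6c` by `…KRSTEdgeVP.not_KRSTSuccinctInVP`), item 18967 would follow.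
[cite: KumarRamyaSaptharishiTengse2022, Thm. MainThm and §4] -/
theorem krstForVP_of_krstSuccinctInVP
    (h : ∀ c m₀ : ℕ, PermanentExpHardWith ℂ c m₀ → ∃ b : ℕ, KRSTDoor.KRSTSuccinctInVP ℂ c b) :
    Theses.BarrierLever.KRSTForVP := by
  rintro ⟨c, m₀, hper⟩
  obtain ⟨b, hb⟩ := h c m₀ hper
  exact KRSTDoor.succinctHittingSetsForVP_of_permanentExpHard hper hb

/-! ### §3 What item 18972 certifies, and its "vanishing + definable non-root" form -/

/-- **Soundness**: item 18972 certifies, for its exponent `b₁` and every `b`, infinitely often a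
member of `VNP_{n,b₁} = SmallDefinable ℂ n b₁` outside `VP_{n,b} = SmallCircuits ℂ n b` (a slice
separation of `VNP` from `VP`). [cite: ForbesShpilkaVolk2018, Def. 1] -/
theorem exists_smallDefinable_not_mem_smallCircuits
    (h : Theses.BarrierLever.NaturalProofsSeparateVNP) :
    ∃ b₁ : ℕ, ∀ b n₀ : ℕ, ∃ n : ℕ, n₀ ≤ n ∧
      ∃ g ∈ SmallDefinable ℂ n b₁, g ∉ SmallCircuits ℂ n b := by
  obtain ⟨b₁, hb₁⟩ := naturalProofsSeparateVNP_iff_exists.mp h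
  refine ⟨b₁, fun b n₀ => ?_⟩
  obtain ⟨n, hn, D, ⟨-, -, hvan⟩, g, hg, hne⟩ := hb₁ b n₀
  exact ⟨n, hn, g, hg, fun hmem => hne (hvan g hmem)⟩

/-- **The shape a CKRST-type construction must deliver to give item 18972**: for one exponent `b₁`,
for every `b`, infinitely often, a level-one distinguisher VANISHING ON ALL of `SmallCircuits ℂ n b`
(all complex coefficients — Chatterjee–Kumar–Ramya–Saptharishi–Tengse 2020, Thm 1.1, has vanishing on
the `{-1,0,1}`-coefficient slice `signCoeffSlice n` only) with a NON-ROOT in `SmallDefinable ℂ n b₁`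
(`D ≠ 0` is then automatic). [cite: ChatterjeeKumarRamyaSaptharishiTengse2020, Thm 1.1] -/
theorem naturalProofsSeparateVNP_iff_vanishing_nonRoot :
    Theses.BarrierLever.NaturalProofsSeparateVNP ↔
      ∃ b₁ : ℕ, ∀ b n₀ : ℕ, ∃ n : ℕ, n₀ ≤ n ∧ ∃ D ∈ Distinguishers ℂ n 1,
        (∀ f ∈ SmallCircuits ℂ n b, eval (coeffVector (degLEMonomials n) f) D = 0) ∧
          ∃ g ∈ SmallDefinable ℂ n b₁, eval (coeffVector (degLEMonomials n) g) D ≠ 0 := by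
  rw [naturalProofsSeparateVNP_iff_exists]
  refine exists_congr fun b₁ => forall_congr' fun b => forall_congr' fun n₀ =>
    exists_congr fun n => and_congr_right fun _ => ⟨?_, ?_⟩
  · rintro ⟨D, ⟨hD, -, hvan⟩, g, hg, hne⟩
    exact ⟨D, hD, hvan, g, hg, hne⟩
  · rintro ⟨D, hD, hvan, g, hg, hne⟩
    have hD0 : D ≠ 0 := by rintro rfl; simp at hne
    exact ⟨D, ⟨hD, hD0, hvan⟩, g, hg, hne⟩

end Summit.ValiantsHypothesis.ValiantsHypothesis.Theorems.BarrierLever.NaturalProofsSeparateVNP
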